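import Literature.MathematicalPhysics.QuantumFieldTheory.Balaban1983to89.MatrixNorms
import Literature.Analysis.Complex.LogOnePlus
import Literature.Analysis.Calculus.ExpDuhamel

/-!
# Bałaban's renormalization group for 4-d lattice Yang–Mills — the logarithm of B7 §A, eqs. (21)–(27) (`MatrixLog`)

CITATION HEADER (lean-in-tree rule 2026-08-18). Companion to `Setup` / `UnitaryModel` / `MatrixNorms` (same series, audit
cell `pub-balaban`, unit b2b-balaban-f1). T. Bałaban, *Averaging operations for lattice gauge theories*, Comm. Math. Phys.
**98** 17–51 (1985) [Balaban1985Averaging] §A pp. 21–22, quoted from the page renders. p. 21: "The first is a logarithmic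
function. It is an inverse to the exponential function and for matrices `X` satisfying `|X − 1| < 1` it is given by
`log X = Σ_{n=1}^∞ ((−1)^{n+1}/n) (X − 1)^n`. (21) Of course, both functions are analytic functions of complex matrices
`X`."; (22) `log X = Σ_j log z_j P_j` for a normal `X = Σ_j z_j P_j` and any branch `log z`; "We will use this definition
for `log z = log|z| + i arg z`, where `arg z ∈ ]−π, π]`, and for unitary matrices. Every unitary matrix `U` can be
represented uniquely in the form `U = Σ_{j=1}^r e^{iλ_j} P_j`, where the numbers `λ_j` are different and satisfy
`λ_j ∈ ]−π, π]`, and then we define `log U = i Σ_j λ_j P_j = iA`, (23) `A` is a hermitian matrix, `|A| ≤ π`. From this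
definition the following inequalities follow:
`|U − 1| = max_j |e^{iλ_j} − 1| = max_j |sin(λ_j/2)/(λ_j/2)| |λ_j| ≤ max_j |λ_j| = |log U|`, (24)
`|log U| ≤ (π/2)|U − 1|`, because `|sin x / x| ≥ 2/π` for `x ∈ [−π/2, π/2]`. (25)". p. 22: "We will need also
inequalities of this type for arbitrary complex matrices `X` instead of `U`. For matrices `X` satisfying `|X − 1| ≤ ½`,
we have `|log X| ≤ Σ_{n=1}^∞ (1/n)|X − 1|^n ≤ |X − 1|/(1 − |X − 1|) ≤ 2|X − 1|`, (26)
`|X − 1| = |e^{log X} − 1| ≤ e^{|log X|} − 1 ≤ e^{|log X|} |log X| ≤ 2|log X|`. (27)"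
Here `|·|` is the operator norm (19) p. 21 = Mathlib's `L²`-operator norm `‖·‖` (scope `Matrix.Norms.L2Operator`), as in
`MatrixNorms`; `|U − 1| = UnitaryModel.opDist1 U`.
WHAT IS REPRODUCED: no theorem of the series; the definitions (21), (23) and the elementary inequalities (24)–(27),
kernel-checked with the printed constants `1`, `π/2`, `2`, `2`:
* (21) `mlog X := Literature.Analysis.Complex.logOnePlus (X − 1)` in any complete normed `ℂ`-algebra `𝔄` (so for `M_N(ℂ)`
  under the scope, which is how p. 22 applies it to non-unitary `X`): the series (`hasSum_mlog`), "inverse to the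
  exponential function" (`exp_mlog`: `e^{log X} = X` for `|X − 1| < 1`, the tree's `exp_logOnePlus_sub_one`), analyticity
  (`analyticAt_mlog`, the tree's `analyticAt_logOnePlus`);
* (26) member by member: `norm_mlog_le_neg_log` (`|log X| ≤ Σ_{n≥1} (1/n)|X − 1|^n`, whose sum is `−ln(1 − |X − 1|)`; all
  `|X − 1| < 1`), `neg_log_one_sub_le_chain` (`−ln(1 − t) ≤ t/(1 − t) ≤ 2t` for `0 ≤ t ≤ ½`), `norm_mlog_le_div`,
  `norm_mlog_le_two_mul` (the tree's `norm_logOnePlus_le`, `norm_logOnePlus_le_two_mul` in the vocabulary (21));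
* (27) member by member: `norm_sub_one_le_exp_norm_mlog_sub_one` (`|X − 1| ≤ e^{|log X|} − 1`, all `|X − 1| < 1`, via the
  tree's `Literature.Analysis.Calculus.norm_exp_sub_one_le`), `norm_mlog_le_log_two`, `norm_sub_one_le_two_mul_norm_mlog`
  (`|X − 1| ≤ 2|log X|` for `|X − 1| ≤ ½`); `opDist1_le_and_le` restates (26)/(27) for matrices with `opDist1`;
* (24), (25) in any C⋆-algebra `A`, read from the Lie-algebra side: for self-adjoint `x`, `‖e^{ix} − 1‖ ≤ ‖x‖` (all `x`;
  `norm_expUnitary_sub_one_le`) and `‖x‖ ≤ (π/2)‖e^{ix} − 1‖` for `‖x‖ ≤ π` (`norm_le_pi_div_two_mul_norm_expUnitary_sub_one`);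
  (23) for a unitary `u` with `‖u − 1‖ < 2`: `A := Unitary.argSelfAdjoint u` (Mathlib: `arg ∈ ]−π, π]` applied through the
  continuous functional calculus, i.e. `Σ_j λ_j P_j` for a matrix; `‖A‖ ≤ π` = `Unitary.norm_argSelfAdjoint_le_pi`,
  `e^{iA} = u` = `expUnitary_argSelfAdjoint`), `|log U| = ‖I • A‖ = ‖A‖` (`norm_I_smul`), and then
  `‖u − 1‖ ≤ ‖A‖ ≤ (π/2)‖u − 1‖` (`unitary_norm_sub_one_le_norm_arg`, `unitary_norm_arg_le`);
* (23)–(25) for unitary MATRICES with no hypothesis `|U − 1| < 2` (finite spectrum, `−1 ∈ σ(U)` allowed):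
  `exists_isHermitian_exp_eq` — every `U ∈ U(N)` is `e^{iA}`, `A` Hermitian, `|A| ≤ π`, `|U − 1| ≤ |A| ≤ (π/2)|U − 1|` — and,
  for a given Hermitian `A`, `opDist1_exp_le` (24) and `norm_le_pi_div_two_mul_opDist1_exp` (25). Mathlib registers no global
  `CStarAlgebra (Matrix n n ℂ)`; as elsewhere in the tree the instance is assembled locally inside the proofs and no matrix
  statement mentions it.
FINDINGS OF THE AUDIT (cell DIVERGENCE.md F15; GAPS.md C-f1-2): (24)–(27) hold as printed. Two remarks. (i) In (27) the member
`e^{|log X|}|log X| ≤ 2|log X|` needs `e^{|log X|} ≤ 2`, i.e. `|log X| ≤ ln 2`; this follows from the FIRST member of (26)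
(`Σ (1/n)|X − 1|^n = −ln(1 − |X − 1|) ≤ ln 2` at `|X − 1| ≤ ½`; `norm_mlog_le_log_two`), not from its last member (`2|X − 1| ≤ 1`
only gives `e^{|log X|} ≤ e`). (ii) For a unitary `U` with `|U − 1| < 1` the paper uses (21) and (23) as one `log U`; they agree
(the spectrum lies in `{|z − 1| < 1}`, inside the principal branch), but that identification is NOT kernel-checked here: the
unitary statements are phrased with `argSelfAdjoint` / `e^{iA}`, the series statements with `mlog`, and no lemma mixes them.
Value = typed vocabulary + kernel certificate of printed elementary inequalities, not summit progress.
-/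

open scoped BigOperators Matrix ComplexConjugate Real
open NormedSpace

namespace Literature.MathematicalPhysics.QuantumFieldTheory.Balaban1983to89

namespace MatrixLog

open Literature.Analysis.Complex (logOnePlus logSeriesCoeff)

noncomputable section

/-! ## (21), (26), (27): the logarithmic series in a complete normed `ℂ`-algebra -/

/-- The coefficients of (26): `‖(−1)^{n+2}/(n+1)‖ = 1/(n+1)`. [folklore] -/
theorem norm_logSeriesCoeff_succ (n : ℕ) : ‖logSeriesCoeff (n + 1)‖ = 1 / (n + 1) := by
  rw [Literature.Analysis.Complex.logSeriesCoeff, norm_div, norm_pow, norm_neg, norm_one, one_pow,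
    Complex.norm_natCast]
  push_cast
  ring

/-- The real inequalities between the three majorants of (26) p. 22: for `0 ≤ t ≤ ½`,
`−ln(1 − t) ≤ t/(1 − t) ≤ 2t` (`1 − 1/y ≤ ln y` at `y = 1 − t`). [cite: Balaban1985Averaging, (26) p.22] -/
theorem neg_log_one_sub_le_chain {t : ℝ} (h0 : 0 ≤ t) (h1 : t ≤ 1 / 2) :
    -Real.log (1 - t) ≤ t / (1 - t) ∧ t / (1 - t) ≤ 2 * t := by
  have ht : 0 < 1 - t := by linarith
  refine ⟨?_, ?_⟩
  · have h := Real.one_sub_inv_le_log_of_pos ht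
    have hid : t / (1 - t) = (1 - t)⁻¹ - 1 := by
      field_simp
      ring
    linarith
  · rw [div_le_iff₀ ht]
    nlinarith

section Series

variable {𝔄 : Type*} [NormedRing 𝔄] [NormedAlgebra ℂ 𝔄]

/-- **(21)** p. 21: `log X = Σ_{n=1}^∞ ((−1)^{n+1}/n) (X − 1)^n` for `|X − 1| < 1` — the tree's logarithmic series
`Literature.Analysis.Complex.logOnePlus` taken at `X − 1`. [cite: Balaban1985Averaging, (21) p.21] -/
def mlog (X : 𝔄) : 𝔄 := logOnePlus (X - 1)

/-- Unfolding (21): `log X = logOnePlus (X − 1)`. [cite: Balaban1985Averaging, (21) p.21] -/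
theorem mlog_def (X : 𝔄) : mlog X = logOnePlus (X - 1) := rfl

/-- `log 1 = 0`. [cite: Balaban1985Averaging, (21) p.21] -/
@[simp] theorem mlog_one : mlog (1 : 𝔄) = 0 := by
  simp [mlog]

variable [CompleteSpace 𝔄]

/-- The series (21) converges to `log X` for `|X − 1| < 1` (term `n = 0` is `0`). [cite: Balaban1985Averaging, (21) p.21] -/
theorem hasSum_mlog {X : 𝔄} (hX : ‖X - 1‖ < 1) :
    HasSum (fun n : ℕ => logSeriesCoeff n • (X - 1) ^ n) (mlog X) :=
  Literature.Analysis.Complex.hasSum_logOnePlus hX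

/-- "It is an inverse to the exponential function" (p. 21): `e^{log X} = X` for `|X − 1| < 1` — the tree's
`Literature.Analysis.Complex.exp_logOnePlus_sub_one`. [cite: Balaban1985Averaging, (21) p.21] -/
theorem exp_mlog {X : 𝔄} (hX : ‖X - 1‖ < 1) : exp (mlog X) = X :=
  Literature.Analysis.Complex.exp_logOnePlus_sub_one hX

/-- "Of course, both functions are analytic functions of complex matrices `X`" (p. 21): `log` is analytic (over `ℂ`)
at every `X` with `|X − 1| < 1` — the tree's `analyticAt_logOnePlus` composed with `X ↦ X − 1`.
[cite: Balaban1985Averaging, (21) p.21] -/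
theorem analyticAt_mlog {X : 𝔄} (hX : ‖X - 1‖ < 1) : AnalyticAt ℂ (mlog : 𝔄 → 𝔄) X := by
  have h : AnalyticAt ℂ (fun Y : 𝔄 => Y - 1) X := analyticAt_id.sub analyticAt_const
  have e : (mlog : 𝔄 → 𝔄) = logOnePlus ∘ fun Y : 𝔄 => Y - 1 := rfl
  rw [e]
  exact AnalyticAt.comp (f := fun Y : 𝔄 => Y - 1) (x := X) (Literature.Analysis.Complex.analyticAt_logOnePlus hX) h

/-- **(26), first member** (p. 22), for all `|X − 1| < 1`: `|log X| ≤ Σ_{n=1}^∞ (1/n)|X − 1|^n`, the right-hand side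
being `−ln(1 − |X − 1|)` (Mathlib `Real.hasSum_pow_div_log_of_abs_lt_one`). This sharper member is the one (27) needs
(`norm_mlog_le_log_two`). [cite: Balaban1985Averaging, (26) p.22] -/
theorem norm_mlog_le_neg_log {X : 𝔄} (hX : ‖X - 1‖ < 1) : ‖mlog X‖ ≤ -Real.log (1 - ‖X - 1‖) := by
  have habs : |‖X - 1‖| < 1 := by rwa [abs_of_nonneg (norm_nonneg _)]
  have hreal : HasSum (fun n : ℕ => ‖X - 1‖ ^ (n + 1) / (n + 1)) (-Real.log (1 - ‖X - 1‖)) :=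
    Real.hasSum_pow_div_log_of_abs_lt_one habs
  have hser : HasSum (fun n : ℕ => logSeriesCoeff (n + 1) • (X - 1) ^ (n + 1)) (mlog X) := by
    have h0 : HasSum (fun n : ℕ => logSeriesCoeff n • (X - 1) ^ n) (mlog X) := hasSum_mlog hX
    have h := (hasSum_nat_add_iff' 1).mpr h0
    simpa using h
  refine hser.norm_le_of_bounded hreal fun n => ?_
  calc ‖logSeriesCoeff (n + 1) • (X - 1) ^ (n + 1)‖
        ≤ ‖logSeriesCoeff (n + 1)‖ * ‖(X - 1) ^ (n + 1)‖ := norm_smul_le _ _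
    _ ≤ 1 / (n + 1) * ‖X - 1‖ ^ (n + 1) := by
        rw [norm_logSeriesCoeff_succ]
        exact mul_le_mul_of_nonneg_left (norm_pow_le' (X - 1) n.succ_pos) (by positivity)
    _ = ‖X - 1‖ ^ (n + 1) / (n + 1) := by ring

/-- **(26), second member**: `|log X| ≤ |X − 1|/(1 − |X − 1|)` for `|X − 1| < 1` — the tree's `norm_logOnePlus_le` in the
vocabulary (21). [cite: Balaban1985Averaging, (26) p.22] -/
theorem norm_mlog_le_div {X : 𝔄} (hX : ‖X - 1‖ < 1) : ‖mlog X‖ ≤ ‖X - 1‖ / (1 - ‖X - 1‖) :=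
  Literature.Analysis.Complex.norm_logOnePlus_le hX

/-- **(26), last member**: `|log X| ≤ 2|X − 1|` for `|X − 1| ≤ ½` — the tree's `norm_logOnePlus_le_two_mul` in the
vocabulary (21). [cite: Balaban1985Averaging, (26) p.22] -/
theorem norm_mlog_le_two_mul {X : 𝔄} (hX : ‖X - 1‖ ≤ 1 / 2) : ‖mlog X‖ ≤ 2 * ‖X - 1‖ :=
  Literature.Analysis.Complex.norm_logOnePlus_le_two_mul hX

/-- **(27), first two members** (p. 22), for all `|X − 1| < 1`: `|X − 1| = |e^{log X} − 1| ≤ e^{|log X|} − 1`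
(`exp_mlog` and the tree's `Literature.Analysis.Calculus.norm_exp_sub_one_le`). [cite: Balaban1985Averaging, (27) p.22] -/
theorem norm_sub_one_le_exp_norm_mlog_sub_one {X : 𝔄} (hX : ‖X - 1‖ < 1) :
    ‖X - 1‖ ≤ Real.exp ‖mlog X‖ - 1 := by
  have h := Literature.Analysis.Calculus.norm_exp_sub_one_le (mlog X)
  rwa [exp_mlog hX] at h

/-- `|log X| ≤ ln 2` for `|X − 1| ≤ ½`, from the FIRST member of (26) (`−ln(1 − ½) = ln 2`); this is what makes the last
member of (27) hold with the printed constant `2` (audit remark (i) of the header). [cite: Balaban1985Averaging, (26)–(27) p.22] -/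
theorem norm_mlog_le_log_two {X : 𝔄} (hX : ‖X - 1‖ ≤ 1 / 2) : ‖mlog X‖ ≤ Real.log 2 := by
  have hX1 : ‖X - 1‖ < 1 := hX.trans_lt (by norm_num)
  refine (norm_mlog_le_neg_log hX1).trans ?_
  have h2 : Real.log 2⁻¹ ≤ Real.log (1 - ‖X - 1‖) := Real.log_le_log (by norm_num) (by linarith)
  rw [Real.log_inv] at h2
  linarith

/-- **(27)** (p. 22): `|X − 1| ≤ 2|log X|` for `|X − 1| ≤ ½` — the chain
`|X − 1| ≤ e^{|log X|} − 1 ≤ e^{|log X|}|log X| ≤ 2|log X|`, the last step by `e^{|log X|} ≤ e^{ln 2} = 2`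
(`norm_mlog_le_log_two`), the middle one by `e^s − 1 ≤ s e^s`. [cite: Balaban1985Averaging, (27) p.22] -/
theorem norm_sub_one_le_two_mul_norm_mlog {X : 𝔄} (hX : ‖X - 1‖ ≤ 1 / 2) : ‖X - 1‖ ≤ 2 * ‖mlog X‖ := by
  have hX1 : ‖X - 1‖ < 1 := hX.trans_lt (by norm_num)
  set s : ℝ := ‖mlog X‖ with hs
  have hs0 : 0 ≤ s := norm_nonneg _
  have h1 : ‖X - 1‖ ≤ Real.exp s - 1 := norm_sub_one_le_exp_norm_mlog_sub_one hX1
  have h2 : Real.exp s - 1 ≤ Real.exp s * s := by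
    have hneg := Real.add_one_le_exp (-s)
    have hpos := Real.exp_pos s
    have hmul : Real.exp s * Real.exp (-s) = 1 := by rw [← Real.exp_add, add_neg_cancel, Real.exp_zero]
    have h := mul_le_mul_of_nonneg_left hneg hpos.le
    rw [hmul] at h
    nlinarith
  have h3 : Real.exp s ≤ 2 := by
    calc Real.exp s ≤ Real.exp (Real.log 2) := Real.exp_le_exp.mpr (norm_mlog_le_log_two hX)
      _ = 2 := Real.exp_log (by norm_num)
  calc ‖X - 1‖ ≤ Real.exp s * s := h1.trans h2
    _ ≤ 2 * s := mul_le_mul_of_nonneg_right h3 hs0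

end Series

/-! ## (23), (24), (25): the logarithm of a unitary, in a C⋆-algebra -/

section CStar

open Complex selfAdjoint Unitary

variable {A : Type*} [CStarAlgebra A]

/-- (23) `log U = iA`: `|log U| = ‖I • A‖ = ‖A‖`. [cite: Balaban1985Averaging, (23) p.21] -/
theorem norm_I_smul (a : A) : ‖(I • a : A)‖ = ‖a‖ := by
  rw [norm_smul, Complex.norm_I, one_mul]

/-- **(24)** p. 21, read from the Lie-algebra side and valid in any C⋆-algebra: for a self-adjoint `x`,
`‖e^{ix} − 1‖ ≤ ‖x‖` (paper, for `U = e^{iA}`, `A = Σ_j λ_j P_j`: `|U − 1| = max_j |e^{iλ_j} − 1|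
= max_j |sin(λ_j/2)/(λ_j/2)| |λ_j| ≤ max_j |λ_j| = |A|`; here from Mathlib's `‖e^{ix} − 1‖² = 2(1 − cos ‖x‖)`
(`selfAdjoint.norm_sq_expUnitary_sub_one`, `‖x‖ ≤ π`) and `1 − θ²/2 ≤ cos θ`; for `‖x‖ > π` the left side is `≤ 2 < π`).
It is also the case `y = 0` of the tree's `Literature.Barriers.QuantumFields.norm_expUnitary_sub_expUnitary_le` (not imported).
[cite: Balaban1985Averaging, (24) p.21] -/
theorem norm_expUnitary_sub_one_le (x : selfAdjoint A) : ‖(expUnitary x - 1 : A)‖ ≤ ‖x‖ := by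
  by_cases hx : ‖x‖ ≤ π
  · have hsq : ‖(expUnitary x - 1 : A)‖ ^ 2 ≤ ‖x‖ ^ 2 := by
      rw [norm_sq_expUnitary_sub_one hx]
      linarith [Real.one_sub_sq_div_two_le_cos (x := ‖x‖)]
    exact (pow_le_pow_iff_left₀ (norm_nonneg _) (norm_nonneg _) two_ne_zero).mp hsq
  · push Not at hx
    have hxne : x ≠ 0 := norm_pos_iff.mp (Real.pi_pos.trans hx)
    haveI : Nontrivial A := ⟨⟨(x : A), 0, by simpa using hxne⟩⟩
    calc ‖(expUnitary x - 1 : A)‖ ≤ ‖(expUnitary x : A)‖ + ‖(1 : A)‖ := norm_sub_le _ _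
      _ = 2 := by rw [CStarRing.norm_coe_unitary, CStarRing.norm_one]; norm_num
      _ ≤ ‖x‖ := by linarith [Real.pi_gt_three]

/-- **(25)** p. 21 in any C⋆-algebra: for a self-adjoint `x` with `‖x‖ ≤ π`, `‖x‖ ≤ (π/2)‖e^{ix} − 1‖` (paper:
"`|log U| ≤ (π/2)|U − 1|`, because `|sin x/x| ≥ 2/π` for `x ∈ [−π/2, π/2]`"; here from `‖e^{ix} − 1‖² = 2(1 − cos ‖x‖)` and
Mathlib's `cos θ ≤ 1 − (2/π²)θ²` for `|θ| ≤ π`, `Real.cos_le_one_sub_mul_cos_sq`). [cite: Balaban1985Averaging, (25) p.21] -/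
theorem norm_le_pi_div_two_mul_norm_expUnitary_sub_one (x : selfAdjoint A) (hx : ‖x‖ ≤ π) :
    ‖x‖ ≤ π / 2 * ‖(expUnitary x - 1 : A)‖ := by
  have hθ : |‖x‖| ≤ π := by rwa [abs_of_nonneg (norm_nonneg _)]
  have hcos := Real.cos_le_one_sub_mul_cos_sq hθ
  have hπ : (0 : ℝ) < π := Real.pi_pos
  have hsq : ‖x‖ ^ 2 ≤ (π / 2 * ‖(expUnitary x - 1 : A)‖) ^ 2 := by
    rw [mul_pow, norm_sq_expUnitary_sub_one hx]
    have hid : (π / 2) ^ 2 * (4 / π ^ 2 * ‖x‖ ^ 2) = ‖x‖ ^ 2 := by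
      field_simp
      ring
    have hinner : 4 / π ^ 2 * ‖x‖ ^ 2 ≤ 2 * (1 - Real.cos ‖x‖) := by
      have e : 4 / π ^ 2 * ‖x‖ ^ 2 = 2 * (2 / π ^ 2 * ‖x‖ ^ 2) := by ring
      rw [e]
      linarith
    have hmono : (π / 2) ^ 2 * (4 / π ^ 2 * ‖x‖ ^ 2) ≤ (π / 2) ^ 2 * (2 * (1 - Real.cos ‖x‖)) :=
      mul_le_mul_of_nonneg_left hinner (by positivity)
    linarith
  exact (pow_le_pow_iff_left₀ (norm_nonneg _) (by positivity) two_ne_zero).mp hsq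

/-- **(23)–(24)** for a unitary `u` of a C⋆-algebra with `‖u − 1‖ < 2`: with `A := Unitary.argSelfAdjoint u` — `arg ∈ ]−π, π]`
applied to `u` through the continuous functional calculus, i.e. for a unitary matrix `U = Σ_j e^{iλ_j} P_j`, `λ_j ∈ ]−π, π]`
distinct, exactly the `A = Σ_j λ_j P_j` of (23); `‖A‖ ≤ π` is Mathlib's `Unitary.norm_argSelfAdjoint_le_pi` and `e^{iA} = u`
its `expUnitary_argSelfAdjoint` — one has `|U − 1| ≤ |A| = |log U|`. [cite: Balaban1985Averaging, (23)–(24) p.21] -/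
theorem unitary_norm_sub_one_le_norm_arg {u : unitary A} (hu : ‖(u - 1 : A)‖ < 2) :
    ‖(u - 1 : A)‖ ≤ ‖argSelfAdjoint u‖ := by
  have h := norm_expUnitary_sub_one_le (argSelfAdjoint u)
  rwa [expUnitary_argSelfAdjoint hu] at h

/-- **(25)** for a unitary `u` of a C⋆-algebra with `‖u − 1‖ < 2`: `|log U| = ‖argSelfAdjoint u‖ ≤ (π/2)‖u − 1‖`.
[cite: Balaban1985Averaging, (25) p.21] -/
theorem unitary_norm_arg_le {u : unitary A} (hu : ‖(u - 1 : A)‖ < 2) :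
    ‖argSelfAdjoint u‖ ≤ π / 2 * ‖(u - 1 : A)‖ := by
  have h := norm_le_pi_div_two_mul_norm_expUnitary_sub_one (argSelfAdjoint u) (norm_argSelfAdjoint_le_pi u)
  rwa [expUnitary_argSelfAdjoint hu] at h

end CStar

/-! ## (23)–(27) for matrices, in the cell's vocabulary (`opDist1 U = |U − 1|`, operator norm (19)) -/

section Matrices

open Complex selfAdjoint Unitary UnitaryModel
open scoped Matrix.Norms.L2Operator

variable {n : Type*} [Fintype n] [DecidableEq n]

/-- **(23), (24), (25)** for unitary matrices (p. 21), with no hypothesis `|U − 1| < 2`: every `U ∈ U(N)` is `U = e^{iA}`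
with `A` Hermitian, `|A| ≤ π` — namely `A = Σ_j λ_j P_j`, `λ_j ∈ ]−π, π]`, i.e. `arg` applied to `U` by the functional calculus
of the C⋆-algebra `M_N(ℂ)` (assembled locally); the spectrum of a matrix is finite, so `arg` is continuous on it and `e^{iA} = U`
holds even when `−1 ∈ σ(U)` (Mathlib's proof of `expUnitary_argSelfAdjoint`, re-run under that continuity hypothesis) — and
then `|U − 1| ≤ |A| ≤ (π/2)|U − 1|`. [cite: Balaban1985Averaging, (23)–(25) p.21] -/
theorem exists_isHermitian_exp_eq {U : Matrix n n ℂ} (hU : U ∈ Matrix.unitaryGroup n ℂ) :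
    ∃ A : Matrix n n ℂ, A.IsHermitian ∧ ‖A‖ ≤ π ∧ exp (I • A) = U ∧
      opDist1 U ≤ ‖A‖ ∧ ‖A‖ ≤ π / 2 * opDist1 U := by
  letI : CStarAlgebra (Matrix n n ℂ) := {}
  let u : unitary (Matrix n n ℂ) := ⟨U, hU⟩
  have huU : (u : Matrix n n ℂ) = U := rfl
  have hc : ContinuousOn arg (spectrum ℂ (u : Matrix n n ℂ)) := (Matrix.finite_spectrum U).continuousOn _
  have hexp : expUnitary (argSelfAdjoint u) = u := by
    apply Subtype.ext
    rw [expUnitary_coe, argSelfAdjoint_coe, ← CFC.exp_eq_normedSpace_exp (𝕜 := ℂ),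
      ← cfc_comp_smul .., ← cfc_comp' ..]
    conv_rhs => rw [← cfc_id' ℂ (u : Matrix n n ℂ)]
    refine cfc_congr fun y hy ↦ ?_
    have hy₁ : ‖y‖ = 1 := spectrum.norm_eq_one_of_unitary u.2 hy
    have : I * y.arg = log y :=
      Complex.ext (by simp [log_re, spectrum.norm_eq_one_of_unitary u.2 hy]) (by simp [log_im])
    simpa [← exp_eq_exp_ℂ, this] using exp_log (by aesop)
  have hexp' : ((expUnitary (argSelfAdjoint u) : unitary (Matrix n n ℂ)) : Matrix n n ℂ) = U := by
    rw [hexp]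
  refine ⟨(argSelfAdjoint u : Matrix n n ℂ), (argSelfAdjoint u).2, norm_argSelfAdjoint_le_pi u, ?_, ?_, ?_⟩
  · simpa [expUnitary_coe] using hexp'
  · have h := norm_expUnitary_sub_one_le (A := Matrix n n ℂ) (argSelfAdjoint u)
    rw [hexp'] at h
    simpa [opDist1] using h
  · have h := norm_le_pi_div_two_mul_norm_expUnitary_sub_one (A := Matrix n n ℂ) (argSelfAdjoint u)
      (norm_argSelfAdjoint_le_pi u)
    rw [hexp'] at h
    simpa [opDist1] using h

/-- **(24)** for matrices: `|e^{iA} − 1| ≤ |A|` for every Hermitian `A` (no restriction on `|A|`).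
[cite: Balaban1985Averaging, (24) p.21] -/
theorem opDist1_exp_le {A : Matrix n n ℂ} (hA : A.IsHermitian) : opDist1 (exp (I • A)) ≤ ‖A‖ := by
  letI : CStarAlgebra (Matrix n n ℂ) := {}
  have h := norm_expUnitary_sub_one_le (A := Matrix n n ℂ) ⟨A, hA.isSelfAdjoint⟩
  simpa [opDist1, expUnitary_coe] using h

/-- **(25)** for matrices: `|A| ≤ (π/2)|e^{iA} − 1|` for every Hermitian `A` with `|A| ≤ π`.
[cite: Balaban1985Averaging, (25) p.21] -/
theorem norm_le_pi_div_two_mul_opDist1_exp {A : Matrix n n ℂ} (hA : A.IsHermitian) (hπ : ‖A‖ ≤ π) :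
    ‖A‖ ≤ π / 2 * opDist1 (exp (I • A)) := by
  letI : CStarAlgebra (Matrix n n ℂ) := {}
  have h := norm_le_pi_div_two_mul_norm_expUnitary_sub_one (A := Matrix n n ℂ) ⟨A, hA.isSelfAdjoint⟩ hπ
  simpa [opDist1, expUnitary_coe] using h

/-- **(26)–(27)** for complex matrices in the cell's vocabulary: if `opDist1 X = |X − 1| ≤ ½` then `|log X| ≤ 2|X − 1|` and
`|X − 1| ≤ 2|log X|` (`log X = mlog X`, the series (21) in `M_N(ℂ)` with the operator norm). [cite: Balaban1985Averaging, (26)–(27) p.22] -/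
theorem opDist1_le_and_le (X : Matrix n n ℂ) (hX : opDist1 X ≤ 1 / 2) :
    ‖mlog X‖ ≤ 2 * opDist1 X ∧ opDist1 X ≤ 2 * ‖mlog X‖ :=
  ⟨norm_mlog_le_two_mul hX, norm_sub_one_le_two_mul_norm_mlog hX⟩

end Matrices

end

end MatrixLog

end Literature.MathematicalPhysics.QuantumFieldTheory.Balaban1983to89
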